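import Summits.BirchSwinnertonDyer.BirchSwinnertonDyer.Theses.UniversalToricDescent
import Summits.BirchSwinnertonDyer.BirchSwinnertonDyer.Theorems.UniversalToricDescentThinCombDefs
import Summits.BirchSwinnertonDyer.BirchSwinnertonDyer.Theorems.SignedBaseChangeAnticyclotomicEisensteinDivisibilityXGrTwoModuleFinite
import Literature.NumberTheory.EllipticCurves.TwoVariableSelmerDual
import Literature.NumberTheory.EllipticCurves.ZpExtensionSplitPrimeLineThroughPair
import Literature.NumberTheory.EllipticCurves.ToricTwoVariablePAdicLFunction
import Summits.BirchSwinnertonDyer.BirchSwinnertonDyer.Theorems.UniversalToricDescentBDPFrameCrossPeriodRigidity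
import HarnessLib

/-!
# Line `thin_comb` — crux `AdditiveSplitIMCInclusionAtThree` (stmt-BirchSwinnertonDyer-20395, THE WALL, UTD r201)
# skeleton of crux idea `thin-comb-reflection` (utd-idea g38/g40; lead cruxlead-20395 g2 request «Lines/thin_comb.lean,
# integral door»), pen bsd-wall-pss3x g7, 2026-08-29; v2 RESHAPED by the lead g2 (frame normalisation + weak reflection);
# v3 RESHAPED by the lead g3 (no-pseudo-null input of the descent made a registered stub).

FRAME (the lead's and the card's currency, `Theorems/UniversalToricDescentThinCombDefs.lean`): `Λ₂(𝒪) = 𝒪⟦T₂⟧⟦T₁⟧`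
(`PowerSeries (PowerSeries 𝒪)`, OUTER `T₁`, INNER `T₂`), `𝒪 = R₀ = unrIntegers 3`; a (𝔭, 𝔭′)-FRAME of the
`ℤ₃²`-tower of `K` is a generator pair `(κ₁, κ₂; γ₁, γ₂)` (`ZpExtension.IsTopGeneratorPair`) with `κ₁` unramified
outside `𝔭`, `κ₂` unramified outside `𝔭′` (so `1 + T₁ ↔ γ₁ = γ_𝔭`, `1 + T₂ ↔ γ₂ = γ_𝔭′`), through which the crux's
anticyclotomic `κ` factors (`pairKer κ₁ κ₂ ≤ ker κ`) with `γ₁γ₂ ∈ ker κ` (the anticyclotomic line is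
`(1 + T₁)(1 + T₂) = 1`, the ideal `𝔞` below) and `γ₂ ≡ γ (mod ker κ)` (on that line `1 + T₂ ↔ γ`, the crux's generator,
so a one-variable series `L(T)` is read as `C L = L(T₂)`); `G` = the image in `Λ₂(R₀)` of a generator `g` of
`ch_{Λ₂}(X₂)`, `X₂ = XGr₂ (W.baseChange K) 3 κ₁ κ₂ 𝔭′ γ₁ γ₂ = X_{∅ at 𝔭, nr at 𝔭′}(E/K̃_∞)` (tree carrier, PINNED).

STUBS (v1 list; current list at the end of this docstring) (6): `stub_frame` (support: the frame exists), `stub_charIdealPrincipal` (support: `ch_{Λ₂}` is principal),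
`stub_algFE` (K4, support-in-print: Nekovář 2006 duality + `c`-transport — `ρ G ∼ G` for a reflection `ρ`),
`stub_twoVarCombSupply` (K2⁺ ⊕ K3, THE research stub: a `ρ`-symmetric two-variable function `L₂` congruent to
`u·L(T₂)` mod `𝔞`, with INTEGRAL thin-comb divisibility `ThinCombDvdInt R₀ 3 G L₂`, and `X₂` torsion),
`stub_rigidity` (K1 = `CombReflectionRigidityInt R₀ 3`, PROVED by the lead, closes by name when
`…ThinCombRigidity.lean` lands), `stub_descent` (S2: `G ∣ L₂` + the congruence ⟹ the crux's inclusion on the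
anticyclotomic line: control `XGr₂ ↠ XAc`, no pseudo-null submodule, Delbourgo/Herbrand specialisation along `𝔞`,
generator-congruence transport `γ₂ ≡ γ`). Composition `AdditiveSplitIMCInclusionAtThree_of` is kernel-checked.
BSD is not proved by any of this; every `stub_*` is `sorry`.

v2 (lead cruxlead-20395 g2, 2026-08-29, RESHAPE after `stub-misstated: stub_frame`). The v1 frame asked the two
split-prime lines (`κ₁` unramified outside `𝔭`, `κ₂` unramified outside `𝔭′`) to form a GENERATOR PAIR with
`κ(γ₁) = −1`, `κ(γ₂) = 1`. That is false whenever the first layer of the anticyclotomic `ℤ₃`-extension is unramified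
(equivalently lies in the Hilbert class field; e.g. `K = ℚ(√−23)`, `3` split, `h_K = 3`): then the `𝔭`-line, the
`𝔭′`-line and `κ` all have the SAME first layer, so no two of them are part of a `ℤ₃`-basis of `Hom(Γ, ℤ₃)`. v2 keeps
ONLY what the mechanism needs: `κ₁` = the `𝔭`-line (so `1 + T₂ ↔ γ₂` spans the saturated `𝔭′`-inertia line: the
comb is VERTICAL and the axis `T₂ = 0` is the CM family `𝛉^{(𝔭)}`), `κ₂` ANY complement, normalised by
`κ(γ₁) = 1` (so `1 + T₁ ↦ 1 + T` on the anticyclotomic line, `T = γ − 1` the crux's variable) and `κ(γ₂) = 3^k`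
for some `k : ℕ` (`k = 0` iff the good case); the anticyclotomic line is the ideal
`𝔞_k = (T₂ − ((1+T₁)^{3^k} − 1))`. The reflection `c∘ι` is then in general NOT an `IsReflection`; the lead's
Part VII theorem `UniversalToricDescentThinComb.dvd_of_weakReflection` needs only a WEAK reflection (fixes constants,
`ρ T₂ ∉ (3, T₂)` — true for `c∘ι` since `cγ₂c` spans the `𝔭`-inertia line `≠` the `𝔭′`-line), so `stub_rigidity`
becomes `stub_weakRigidity` (closed by name by that theorem) and K4 (`ρ G ∼ G`, in print: Nekovář + `c`-transport)
is folded into the research stub as a conjunct sharing the witness `ρ` with K3's `ρ L₂ ∼ L₂` (an un-pinned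
`∀ ρ weak → ρ L₂ ∼ L₂` would be false). Stubs v2 (5): `stub_frame`, `stub_charIdealPrincipal` (landed p692284),
`stub_twoVarCombSupply`, `stub_weakRigidity` (landed once Part VII p693012 is in the tree), `stub_descent`.
v3 (lead cruxlead-20395 g3, 2026-08-29, RESHAPE after `stub-misstated: stub_descent` (v2)). `stub_frame` v2 LANDED (p696267).
The v2 glue `stub_descent` asked for `(L) ⊆ ch_Λ(X_ac)·R₀⟦T⟧` from `G ∣ L₂`, `L₂ ≡ u·L(T₁) (mod 𝔞_k)`, finite
generation, torsion and `ch_{Λ₂}(X₂) = (g)` ALONE. That implication is not provable from its binders (and is a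
genuine arithmetic statement): with `L₂ := G`, `L := φ_k(G)` (`φ_k : Λ₂(R₀) ↠ R₀⟦T⟧`, `T₁ ↦ T`,
`1 + T₂ ↦ (1+T)^{3^k}`, kernel `𝔞_k`) all its hypotheses hold, and its conclusion `φ_k(g) ∈ ch_Λ(X_ac)` is, by the
Herbrand specialisation `ch_Λ(X₂/𝔞_k X₂) = ch_Λ(X₂[𝔞_k]) · φ_k(ch_{Λ₂} X₂)` and exact control `X₂/𝔞_k X₂ ≃ X_ac`,
EQUIVALENT to «`X₂[𝔞_k]` is `Λ`-pseudo-null (finite)» — the no-pseudo-null input of every printed two-variable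
descent (Greenberg 2016 Prop. 4.1.1; Skinner–Urban 2014 §3.2 / Cor. 3.2.9; the sibling line `bdpline` on
stmt-…-20727 carries it as `stub_noPseudoNullSS`). v3 makes it a registered stub: `stub_noPseudoNull` (support, in
print: every pseudo-null `Λ₂`-submodule of `X₂` is FINITE — Greenberg's «almost divisible», S3n′ shape of the tree's
`PrintCf2.TwoVarSpecializationFinite`) and `stub_descent` (v3) takes it as a hypothesis; nothing else changes.
Stubs v3 (6): `stub_frame` (landed p696267), `stub_charIdealPrincipal` (landed p692284), `stub_twoVarCombSupply`
(research), `stub_weakRigidity` (landed p694324), `stub_noPseudoNull` (NEW, support/print), `stub_descent` (v3, glue L).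

v4 PROPOSAL (pen bsd-wall-pss3x g7, 2026-08-29 05:3xZ — NOT registered; the lead adopts it by copying this file over
`Lines/thin_comb.lean` with the namespace renamed back to `…ThinComb` and re-running `ledger skeleton check`). D1 LANDED
(`defn-IsToricTwoVarLFunction`, p697787, `Literature/NumberTheory/EllipticCurves/ToricTwoVariablePAdicLFunction.lean`):
the research stub `stub_twoVarCombSupply` (K2⁺ ⊕ K3 ⊕ K4 with a SHARED ∃-witness `L₂`) is SPLIT along the predicate into
`stub_toricTwoVarL` (K3, ∃: a PINNED toric two-variable function for the crux's periods + the anticyclotomic comparison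
K3(ii)) and `stub_combDivisibility` (K2⁺ ⊕ K4, ∀ over PINNED `L₂`: torsion, the weak reflection with `ρ G ∼ G`,
`ρ L₂ ∼ L₂`, and `ThinCombDvdInt`) — «same `_of` modulo one binder» as announced on the line card (rev 3/4); landed stubs
and `stub_noPseudoNull` / `stub_descent` (v3) VERBATIM. Stubs v4 (7 = the cap): `stub_frame` (landed), `stub_charIdealPrincipal`
(landed), `stub_toricTwoVarL` (research ∃), `stub_combDivisibility` (research ∀), `stub_weakRigidity` (landed),
`stub_noPseudoNull` (print), `stub_descent` (v3 glue). If the lead wants K3(ii) as its own support stub (it is M–L from the D1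
API: `exists_hasValueAt₂_and_bdp` + one-variable identity principle along `𝔞_k` + substitution congruence), retire a landed
stub from the registered list to stay ≤ 7.
v4.1 (05:5xZ, utd-idea g45 AUDIT LENS-MEMO-UTD-IDEA-v45 §1 F1 / S-g45-1 ADOPTED verbatim = probe `Sketch-utd-idea-g45.lean`
4e0abeb665c9abfc): `stub_toricTwoVarL` concludes `∃ Ωp' ≠ 0, ∃ L₂, IsToricTwoVarLFunction … ΩK Ωp' L₂ ∧ (congruence)` and `_of`
feeds `Ωp'`, `hΩp'` to `stub_combDivisibility` (already `∀ ΩK Ωp L₂`); K3(ii) thereby carries the one-variable period-rigidity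
content (two BDP-admissible `(Ωp, L)` differ by `L ↦ (1+T)^c·L`, `(Ωp/Ωp')⁸ = w^c` — M–L, optional separate support stub);
F2 calibration: effective typed ranges at `p = 3` are `n` even (BDP) and `a, b` both even (toric).
v4.2 (06:1xZ, utd-idea g46 TURNKEY S-g46-1 ADOPTED verbatim = probe `Sketch-utd-idea-g46.lean` 31084e5f106b7c89): K3 DECOUPLED FROM
THE HANDED FRAME — `stub_toricTwoVarL` concludes `∃ (ΩK′ : ℂ) (Ωp′ : ℂ_[3]) (L₂ : Λ₂(R₀)) (L♮ : R₀⟦T⟧), ΩK′ ≠ 0 ∧ Ωp′ ≠ 0 ∧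
IsToricTwoVarLFunction … ΩK′ Ωp′ L₂ ∧ IsBDPLFunction ι′ 𝔭 κ γ Dt.f ΩK′ Ωp′ L♮ ∧ ∃ u : Λ₂ˣ, L₂ − u·L♮(T₁) ∈ 𝔞_k` (a toric
function WITH ITS OWN BDP companion at the same existential period pair — Castella–Wan Thm 2.11 + Cor 2.12 shape at the additive 3;
the handed `(ΩK, Ωp, L)` stay hypotheses = existence insurance only), and `AdditiveSplitIMCInclusionAtThree_of` moves from `L♮` to
the handed `L` by the LANDED cross-period rigidity theorem `…Theorems.UniversalToricDescentTwinSplit.span_singleton_eq_of_isBDPLFunction`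
(utd-p2 p536114; import `…Theorems.UniversalToricDescentBDPFrameCrossPeriodRigidity`): `Ideal.span {L♮} = Ideal.span {L}`, then
`stub_descent … L₂ L♮`. No period torsor / parity calibration is left inside the research stub. rc 0 · 7 sorries = 7 stubs · `_of` BY NAME.
STILL A PROPOSAL (namespace `…ThinCombV4Pen`); the lead registers or not.
-/

set_option linter.dupNamespace false
set_option autoImplicit false

noncomputable section

open NumberField IsDedekindDomain Field
open Literature.NumberTheory.EllipticCurves
open Summit.BirchSwinnertonDyer.BirchSwinnertonDyer.Theorems.UniversalToricDescentThinComb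

namespace Summit.BirchSwinnertonDyer.BirchSwinnertonDyer.Cruxes.AdditiveSplitIMCInclusionAtThree.ThinCombV4Pen

/-- **stub_frame** (support, M; v2): a 𝔭-ADAPTED NORMALISED frame of the `ℤ₃²`-tower exists: a generator pair
`(κ₁, κ₂; γ₁, γ₂)` presenting a tower through which the anticyclotomic `κ` factors, with `κ₁` unramified outside
`𝔭` (so `γ₂` spans the saturated `𝔭′`-inertia line and the comb `1 + T₂ = ζ` is the family of `3`-power twists
along the CM axis `𝛉^{(𝔭)}`), `κ(γ₁) = 1` (`γ₁ ≡ γ`: on the anticyclotomic line `1 + T₁ ↦ 1 + T`) and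
`κ(γ₂) = 3^k` for some `k : ℕ` (`1 + T₂ ↦ (1 + T)^{3^k}`; `k = 0` unless the first anticyclotomic layer is
unramified, e.g. `K = ℚ(√−23)`). NO condition on `κ₂` (v1's «`κ₂` unramified outside `𝔭′`» + «`κ(γ₂) = 1`» is false
in the `k ≥ 1` case). Construction: present the tower by (cyclotomic-from-`ℚ`, `κ`) (tree
`exists_zpExtension_fixed_by_conj`, `c`-(anti)invariance and `2 ∈ ℤ₃ˣ`), take `κ₁` := the `𝔭`-line inside it (tree
`exists_le_kerSubgroup_inertia_of_isTopGeneratorPair` + `ZpExtensionUnramifiedProofs` away from `3`), rescale `κ₁` by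
a unit so that some `γ₁` with `κ γ₁ = 1` has `κ₁ γ₁ = 1`, pick `γ₂ ∈ ker κ₁` with `κ γ₂ = 3^k` (closed subgroups of
`ℤ₃`), and `κ₂` := the dual functional (tree `ofLinComb`). (de Shalit II.1, II.4.17; Greenberg 1978 §4; Brink 2007
§II for the class-field interaction.) -/
theorem stub_frame :
    ∀ (K : Type) [Field K] [NumberField K], IsImaginaryQuadratic K →
    ∀ (κ : ZpExtension K 3), κ.IsAnticyclotomic → ∀ (γ : Field.absoluteGaloisGroup K), κ.IsTopGenerator γ →
    ∀ (𝔭 : HeightOneSpectrum (𝓞 K)), ((3 : ℕ) : 𝓞 K) ∈ 𝔭.asIdeal →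
    ∀ (𝔭' : HeightOneSpectrum (𝓞 K)), ((3 : ℕ) : 𝓞 K) ∈ 𝔭'.asIdeal → 𝔭' ≠ 𝔭 →
    ∃ (κ₁ κ₂ : ZpExtension K 3) (γ₁ γ₂ : Field.absoluteGaloisGroup K) (k : ℕ),
      ZpExtension.IsTopGeneratorPair κ₁ κ₂ γ₁ γ₂ ∧
      (∀ v : HeightOneSpectrum (𝓞 K), v ≠ 𝔭 → ∀ 𝔓 ∈ v.primesAbove,
        𝔓.inertia (Field.absoluteGaloisGroup K) ≤ κ₁.kerSubgroup) ∧
      ZpExtension.pairKer κ₁ κ₂ ≤ κ.kerSubgroup ∧ γ₁ * γ⁻¹ ∈ κ.kerSubgroup ∧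
      γ₂ * (γ ^ (3 ^ k))⁻¹ ∈ κ.kerSubgroup := by
  sorry

/-- **stub_charIdealPrincipal** (support, S/M): characteristic ideals over `Λ₂ = ℤ₃⟦T₂⟧⟦T₁⟧` are principal
(`Λ₂` is a UFD — tree `IwasawaTheory.uniqueFactorizationMonoid_powerSeries_powerSeries` — so its height-one
primes are principal and `Module.charIdeal` is a finite-or-junk product of their powers; Washington §13.2). -/
theorem stub_charIdealPrincipal :
    ∀ (M : Type) [AddCommGroup M] [Module (IwasawaAlgebra₂ 3) M],
      (Literature.NumberTheory.EllipticCurves.Module.charIdeal (IwasawaAlgebra₂ 3) M).IsPrincipal := by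
  sorry

/-- **stub_toricTwoVarL** (K3, crux-research ∃, L–XL; v4.2 probe = v4.1 with the handed frame DECOUPLED): in a v2
frame, and given that SOME BDP frame `(ΩK, Ωp, L)` of `f_E` at `(ι′, 𝔭)` exists (hypothesis only — existence insurance,
the conclusion does not mention it), there are a period pair `(ΩK′, Ωp′) ∈ ℂˣ × ℂ₃ˣ`, a two-variable TORIC function
`L₂ ∈ Λ₂(R₀)` satisfying the landed D1 predicate `IsToricTwoVarLFunction` (Castella–Wan Thm 2.11 shape: interpolation of
`L(f_E/K, ψ, 1)` on the 𝛉-dominant cone `(a, −b)`, `a, b ≥ 1`, avatars through the pair; level-read Euler factor `= 1` at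
the additive `3`) AND a one-variable BDP companion `L♮ ∈ R₀⟦T⟧` (`IsBDPLFunction ι′ 𝔭 κ γ f ΩK′ Ωp′ L♮`, SAME period
pair), congruent on the anticyclotomic line: `L₂ − u·L♮(T₁) ∈ 𝔞_k` for a unit `u` (`u = 1` expected: restrict `L₂`
along `T₂ ↦ (1+T₁)^{3^k} − 1`; at a BDP character `φ` through `κ` the point `(φ̂(γ₁) − 1, φ̂(γ₂) − 1)` lies on that line
because `γ₁ ≡ γ`, `γ₂ ≡ γ^{3^k}` mod `ker κ`, and `IsToricTwoVarLFunction.hasValueAt₂_centralRay` prescribes there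
EXACTLY the BDP value at the same periods; Castella–Wan Cor 2.12). v4.2 vs v4.1: v4.1 concluded `L₂ − u·L(T₁) ∈ 𝔞_k`
for the crux's ∀-handed `L` at `(ΩK, Ωp)`, so its prover had to move across `p`-adic periods inside the research stub
(utd-idea g45 F1 period torsor, `∃ Ωp′` + `u`); here that transfer is done in `AdditiveSplitIMCInclusionAtThree_of` by
the landed theorem `UniversalToricDescentTwinSplit.span_singleton_eq_of_isBDPLFunction` (utd-p2, p536114), and K3 is a
statement about the 𝛉-dominant construction ALONE. BEYOND PRINT at `p = 3 ∣ N` (CW Thm 2.11 is `p ∤ 6N`); why it might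
fail: as v4.1 — the 𝛉^{(𝔭)}-dominant Hida/Ichino constants at a supercuspidal `3` may carry a local toric period that is
not a `3`-adic unit uniformly in `ψ` («D1-deep» fallback on the line card). -/
theorem stub_toricTwoVarL :
    ∀ (W : WeierstrassCurve ℚ) [W.IsElliptic] [W.IsGloballyMinimal] (N : ℕ) [NeZero N] (K : Type) [Field K]
      [NumberField K] (Dt : Literature.NumberTheory.EllipticCurves.ModularForms.ModularParametrizationData W N),
    Summit.BirchSwinnertonDyer.Rank1Residual.Additive.ClassO6 W 3 → W.HasSurjectiveModNGaloisRep 3 →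
    W.analyticRank = 1 → W.conductorNorm ℤ = N → IsImaginaryQuadratic K → SatisfiesHeegnerHypothesis N K →
    ∀ (κ : ZpExtension K 3), κ.IsAnticyclotomic → ∀ (γ : Field.absoluteGaloisGroup K) [Fact (κ.IsTopGenerator γ)]
      (𝔭 : HeightOneSpectrum (𝓞 K)), ((3 : ℕ) : 𝓞 K) ∈ 𝔭.asIdeal →
      𝔭.asIdeal.ramificationIdx (𝓞 ℚ) = 1 → 𝔭.asIdeal.inertiaDeg (𝓞 ℚ) = 1 →
    ∀ (𝔭' : HeightOneSpectrum (𝓞 K)), ((3 : ℕ) : 𝓞 K) ∈ 𝔭'.asIdeal → 𝔭' ≠ 𝔭 →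
    ∀ (ι' : PadicAlgCl 3 ≃+* ℂ), Summit.BirchSwinnertonDyer.BirchSwinnertonDyer.Theorems.SchneiderFree.BranchInducesPrime 3 ι' 𝔭 →
    ∀ (κ₁ κ₂ : ZpExtension K 3) (γ₁ γ₂ : Field.absoluteGaloisGroup K) (k : ℕ)
      [Fact (ZpExtension.IsTopGeneratorPair κ₁ κ₂ γ₁ γ₂)],
    (∀ v : HeightOneSpectrum (𝓞 K), v ≠ 𝔭 → ∀ 𝔓 ∈ v.primesAbove,
        𝔓.inertia (Field.absoluteGaloisGroup K) ≤ κ₁.kerSubgroup) →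
    ZpExtension.pairKer κ₁ κ₂ ≤ κ.kerSubgroup → γ₁ * γ⁻¹ ∈ κ.kerSubgroup → γ₂ * (γ ^ (3 ^ k))⁻¹ ∈ κ.kerSubgroup →
    ∀ (ΩK : ℂ) (Ωp : ℂ_[3]) (L : UnrSeries 3), ΩK ≠ 0 → Ωp ≠ 0 →
      IsBDPLFunction ι' 𝔭 κ γ Dt.f ΩK Ωp L →
    ∃ (ΩK' : ℂ) (Ωp' : ℂ_[3]) (L₂ : PowerSeries (PowerSeries (unrIntegers 3))) (L' : UnrSeries 3),
      ΩK' ≠ 0 ∧ Ωp' ≠ 0 ∧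
      IsToricTwoVarLFunction ι' 𝔭 𝔭' κ₁ κ₂ γ₁ γ₂ Dt.f ΩK' Ωp' L₂ ∧
      IsBDPLFunction ι' 𝔭 κ γ Dt.f ΩK' Ωp' L' ∧
      ∃ u : (PowerSeries (PowerSeries (unrIntegers 3)))ˣ,
        L₂ - u * PowerSeries.map (PowerSeries.C (R := unrIntegers 3)) L' ∈
          Ideal.span {T₂ (unrIntegers 3) - ((1 + T₁ (unrIntegers 3)) ^ (3 ^ k) - 1)} := by
  sorry

/-- **stub_combDivisibility** (K2⁺ ⊕ K4, crux-research ∀, XL; v4 — second half of the v3 research stub): in a v2 frame,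
for every two-variable function `L₂` PINNED by `IsToricTwoVarLFunction` (so no junk witnesses: the predicate determines
`L₂` — identity principle `IsToricTwoVarLFunction.eq_of_infinite` in a product-adapted frame, transported by a generator
change): `X₂` is `Λ₂`-torsion (kept HERE, utd-idea g44 §4), and there is a WEAK REFLECTION `ρ` (fixes constants,
`ρ T₂ ∉ (3, T₂)`; meant `c∘ι`, which qualifies because `cγ₂c` spans the `𝔭`-inertia line ≠ the `𝔭′`-line) with
`ρ G ∼ G` (K4 — in print for every `E`: Nekovář 2006 Greenberg duality + transport by `c`), `ρ L₂ ∼ L₂` (K3(iii): the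
functional equation of the PINNED `L₂`, unit root number factor — now a definite claim, no shared-witness device needed)
and INTEGRAL thin-comb divisibility `ThinCombDvdInt R₀ 3 G L₂` (`L₂ ∈ (G, E_m(T₂))` on levels of unbounded order:
`𝔭`-branch Beilinson–Flach classes per 3-power twist, 𝛉-dominant explicit reciprocity at the SUPERCUSPIDAL 3,
slack-free Λ-adic Kolyvagin bound — BEYOND PRINT; why it might fail: no reciprocity law at supercuspidal `p ∣ N` in
print, and the slack-free bound may hold on no level — then only the rational door `Cruxes/ToricTransportModThree/
Lines/ratwall_thin_comb.lean` of the parent 20186 remains). VACUITY NOTE: if no `L₂` satisfies the predicate this stub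
is vacuous and ALL the weight sits on `stub_toricTwoVarL`; the predicate itself is non-vacuous (for every `(a, b)` with
`a ≡ b (mod 2)` a suitable power of an unramified type-`(a, −b)` character factors through the pair). -/
theorem stub_combDivisibility :
    ∀ (W : WeierstrassCurve ℚ) [W.IsElliptic] [W.IsGloballyMinimal] (N : ℕ) [NeZero N] (K : Type) [Field K]
      [NumberField K] (Dt : Literature.NumberTheory.EllipticCurves.ModularForms.ModularParametrizationData W N),
    Summit.BirchSwinnertonDyer.Rank1Residual.Additive.ClassO6 W 3 → W.HasSurjectiveModNGaloisRep 3 →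
    W.analyticRank = 1 → W.conductorNorm ℤ = N → IsImaginaryQuadratic K → SatisfiesHeegnerHypothesis N K →
    ∀ (𝔭 : HeightOneSpectrum (𝓞 K)), ((3 : ℕ) : 𝓞 K) ∈ 𝔭.asIdeal →
      𝔭.asIdeal.ramificationIdx (𝓞 ℚ) = 1 → 𝔭.asIdeal.inertiaDeg (𝓞 ℚ) = 1 →
    ∀ (𝔭' : HeightOneSpectrum (𝓞 K)), ((3 : ℕ) : 𝓞 K) ∈ 𝔭'.asIdeal → 𝔭' ≠ 𝔭 →
    ∀ (ι' : PadicAlgCl 3 ≃+* ℂ), Summit.BirchSwinnertonDyer.BirchSwinnertonDyer.Theorems.SchneiderFree.BranchInducesPrime 3 ι' 𝔭 →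
    ∀ (κ₁ κ₂ : ZpExtension K 3) (γ₁ γ₂ : Field.absoluteGaloisGroup K)
      [Fact (ZpExtension.IsTopGeneratorPair κ₁ κ₂ γ₁ γ₂)],
    (∀ v : HeightOneSpectrum (𝓞 K), v ≠ 𝔭 → ∀ 𝔓 ∈ v.primesAbove,
        𝔓.inertia (Field.absoluteGaloisGroup K) ≤ κ₁.kerSubgroup) →
    ∀ (g : IwasawaAlgebra₂ 3),
      Literature.NumberTheory.EllipticCurves.Module.charIdeal (IwasawaAlgebra₂ 3)
        ((W.baseChange K).XGr₂ 3 κ₁ κ₂ 𝔭' γ₁ γ₂) = Ideal.span {g} →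
    ∀ (ΩK : ℂ) (Ωp : ℂ_[3]) (L₂ : PowerSeries (PowerSeries (unrIntegers 3))), ΩK ≠ 0 → Ωp ≠ 0 →
      IsToricTwoVarLFunction ι' 𝔭 𝔭' κ₁ κ₂ γ₁ γ₂ Dt.f ΩK Ωp L₂ →
    Module.IsTorsion (IwasawaAlgebra₂ 3) ((W.baseChange K).XGr₂ 3 κ₁ κ₂ 𝔭' γ₁ γ₂) ∧
    ∃ (ρ : PowerSeries (PowerSeries (unrIntegers 3)) ≃+* PowerSeries (PowerSeries (unrIntegers 3))),
      (∀ c : unrIntegers 3, ρ (const (unrIntegers 3) c) = const (unrIntegers 3) c) ∧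
      ρ (T₂ (unrIntegers 3)) ∉ Ideal.span {const (unrIntegers 3) ((3 : ℕ) : unrIntegers 3), T₂ (unrIntegers 3)} ∧
      Associated (ρ (PowerSeries.map (PowerSeries.map
        (Summit.BirchSwinnertonDyer.Rank1Residual.X11b.Halves.toUnr 3)) g))
        (PowerSeries.map (PowerSeries.map (Summit.BirchSwinnertonDyer.Rank1Residual.X11b.Halves.toUnr 3)) g) ∧
      Associated (ρ L₂) L₂ ∧
      ThinCombDvdInt (unrIntegers 3) 3
        (PowerSeries.map (PowerSeries.map (Summit.BirchSwinnertonDyer.Rank1Residual.X11b.Halves.toUnr 3)) g) L₂ := by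
  sorry

/-- **stub_weakRigidity** (K1 for WEAK reflections, support — PROVED by the lead:
`UniversalToricDescentThinComb.dvd_of_weakReflection` in `Theorems/UniversalToricDescentThinCombWeakReflection.lean`,
p693012; closes BY NAME as soon as that file is in the tree): over `R₀ = unrIntegers 3`, if `ρ` fixes constants and
`ρ T₂ ∉ (3, T₂)`, and `G, F` are `ρ`-symmetric up to units with `F ∈ (G, E_m(T₂))` on comb levels of unbounded order,
then `G ∣ F`. (v1's `stub_rigidity : CombReflectionRigidityInt (unrIntegers 3) 3`, landed p692056, is the special
case of an `IsReflection`.) -/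
theorem stub_weakRigidity :
    ∀ (ρ : PowerSeries (PowerSeries (unrIntegers 3)) ≃+* PowerSeries (PowerSeries (unrIntegers 3))),
      (∀ c : unrIntegers 3, ρ (const (unrIntegers 3) c) = const (unrIntegers 3) c) →
      ρ (T₂ (unrIntegers 3)) ∉ Ideal.span {const (unrIntegers 3) ((3 : ℕ) : unrIntegers 3), T₂ (unrIntegers 3)} →
      ∀ (G F : PowerSeries (PowerSeries (unrIntegers 3))), Associated (ρ G) G → Associated (ρ F) F →
        ThinCombDvdInt (unrIntegers 3) 3 G F → G ∣ F := by
  sorry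

/-- **stub_noPseudoNull** (support, in print, L; v3 — NEW): in a v2 frame, if `X₂ = X_{∅ at 𝔭, nr at 𝔭′}(E/K̃_∞)`
is finitely generated and torsion over `Λ₂ = ℤ₃⟦T₂⟧⟦T₁⟧`, then every PSEUDO-NULL `Λ₂`-submodule of `X₂` is FINITE
(Greenberg's «`S` almost divisible ⟺ its dual has no non-zero pseudo-null submodule», a fortiori the S3n′ shape used
by the tree's `PrintCf2.TwoVarSpecializationFinite` / `SignedBaseChangeAcDivSpecialization.S2`). In print: Greenberg
2016 Prop. 4.1.1 (RFX, LEO, LOC⁽²⁾ for twist deformations §4.3; LOC⁽¹⁾ at a prime not split completely in `K̃_∞`;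
`𝓛` almost divisible: no condition above `𝔭`, unramified above `𝔭′`; CRK from torsion; (a) `E(K̃_∞)[3] = 0` from
`ρ̄` onto) + the Shapiro descent `S_𝓛(K, T ⊗ Λ₂) ≅ Sel(K̃_∞)` (Greenberg §4.3 p. 21, «[Gr6]»); the tree holds
Prop. 4.1.1 as the named fact `Greenberg2016.prop411_selmer_isAlmostDivisible`. Why it might fail: the unramified
local condition above the ADDITIVE prime `𝔭′ ∣ 3` must be almost `Λ₂`-divisible (Prop. 4.2.2 needs `H²(K_η, C_η) = 0`
for a coreflexive `C_η`); not checked in print at potentially supersingular wild `3`. -/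
theorem stub_noPseudoNull :
    ∀ (W : WeierstrassCurve ℚ) [W.IsElliptic] [W.IsGloballyMinimal] (K : Type) [Field K] [NumberField K],
    Summit.BirchSwinnertonDyer.Rank1Residual.Additive.ClassO6 W 3 → W.HasSurjectiveModNGaloisRep 3 →
    IsImaginaryQuadratic K →
    ∀ (κ : ZpExtension K 3), κ.IsAnticyclotomic → ∀ (γ : Field.absoluteGaloisGroup K) [Fact (κ.IsTopGenerator γ)]
      (𝔭 : HeightOneSpectrum (𝓞 K)), ((3 : ℕ) : 𝓞 K) ∈ 𝔭.asIdeal →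
    ∀ (𝔭' : HeightOneSpectrum (𝓞 K)), ((3 : ℕ) : 𝓞 K) ∈ 𝔭'.asIdeal → 𝔭' ≠ 𝔭 →
    ∀ (κ₁ κ₂ : ZpExtension K 3) (γ₁ γ₂ : Field.absoluteGaloisGroup K) (k : ℕ)
      [Fact (ZpExtension.IsTopGeneratorPair κ₁ κ₂ γ₁ γ₂)],
    (∀ v : HeightOneSpectrum (𝓞 K), v ≠ 𝔭 → ∀ 𝔓 ∈ v.primesAbove,
        𝔓.inertia (Field.absoluteGaloisGroup K) ≤ κ₁.kerSubgroup) →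
    ZpExtension.pairKer κ₁ κ₂ ≤ κ.kerSubgroup → γ₁ * γ⁻¹ ∈ κ.kerSubgroup → γ₂ * (γ ^ (3 ^ k))⁻¹ ∈ κ.kerSubgroup →
    Module.Finite (IwasawaAlgebra₂ 3) ((W.baseChange K).XGr₂ 3 κ₁ κ₂ 𝔭' γ₁ γ₂) →
    Module.IsTorsion (IwasawaAlgebra₂ 3) ((W.baseChange K).XGr₂ 3 κ₁ κ₂ 𝔭' γ₁ γ₂) →
    ∀ N : Submodule (IwasawaAlgebra₂ 3) ((W.baseChange K).XGr₂ 3 κ₁ κ₂ 𝔭' γ₁ γ₂),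
      Literature.NumberTheory.EllipticCurves.Module.IsPseudoNull (IwasawaAlgebra₂ 3) N → Finite N := by
  sorry

/-- **stub_descent** (S2, support/glue, L; v3 = v2 + the no-pseudo-null hypothesis S3n′): two-variable divisibility
`G ∣ L₂` in `Λ₂(R₀)` for the PINNED `G` plus
the congruence `L₂ ≡ u·L(T₁) (mod 𝔞_k)`, `𝔞_k = (T₂ − ((1+T₁)^{3^k} − 1))` the anticyclotomic line of a v2 frame
(`γ₁ ≡ γ`, `γ₂ ≡ γ^{3^k}` modulo `ker κ`), give the crux's inclusion `(L) ⊆ ch_Λ(X_ac(E/K_∞)_{∅,0})·R₀⟦T⟧`. Inputs: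
`Λ₂(R₀)/𝔞_k ≅ R₀⟦T₁⟧` (substitution of the inner variable by `(1+T₁)^{3^k} − 1`); control `XGr₂ ⧸ 𝔞_k ↠ XAc`
semilinear along `φ_k : T₁ ↦ T`, `1+T₂ ↦ (1+T)^{3^k}` (restriction from `K_∞^{ac}` to `K̃_∞`; tree `XGr₂.toXAc` is
the `T₁ ↦ 0` variant — same argument, `E(K)[3] = 0` from `ρ̄` onto, tree `torsionBy_eq_bot_of_isImaginaryQuadratic`);
the HYPOTHESIS S3n′ (every pseudo-null `Λ₂`-submodule of `X₂` finite = `stub_noPseudoNull`) kills the Herbrand junk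
factor `ch_Λ(X₂[𝔞_k])`; Herbrand along `𝔞_k` = the tree's `T₁ ↦ 0` specialisation
(`SignedBaseChangeAcDivSpecialization`, `PrintCf2.TwoVarSpecializationFinite`) transported along the `Λ₂`-automorphism
`α_k : T₁ ↦ T₂ − ((1+T₁)^{3^k} − 1), T₂ ↦ T₁` (`constantCoeff ∘ α_k⁻¹ = φ_k`); multiplicativity of `ch`
(SU14 Cor. 3.2.9; BCS 2405.00270 §4.1). v2's version WITHOUT S3n′ was `stub-misstated` (module docstring). -/
theorem stub_descent :
    ∀ (W : WeierstrassCurve ℚ) [W.IsElliptic] [W.IsGloballyMinimal] (K : Type) [Field K] [NumberField K],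
    Summit.BirchSwinnertonDyer.Rank1Residual.Additive.ClassO6 W 3 → W.HasSurjectiveModNGaloisRep 3 →
    IsImaginaryQuadratic K →
    ∀ (κ : ZpExtension K 3), κ.IsAnticyclotomic → ∀ (γ : Field.absoluteGaloisGroup K) [Fact (κ.IsTopGenerator γ)]
      (𝔭 : HeightOneSpectrum (𝓞 K)), ((3 : ℕ) : 𝓞 K) ∈ 𝔭.asIdeal →
    ∀ (𝔭' : HeightOneSpectrum (𝓞 K)), ((3 : ℕ) : 𝓞 K) ∈ 𝔭'.asIdeal → 𝔭' ≠ 𝔭 →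
    ∀ (κ₁ κ₂ : ZpExtension K 3) (γ₁ γ₂ : Field.absoluteGaloisGroup K) (k : ℕ)
      [Fact (ZpExtension.IsTopGeneratorPair κ₁ κ₂ γ₁ γ₂)],
    (∀ v : HeightOneSpectrum (𝓞 K), v ≠ 𝔭 → ∀ 𝔓 ∈ v.primesAbove,
        𝔓.inertia (Field.absoluteGaloisGroup K) ≤ κ₁.kerSubgroup) →
    ZpExtension.pairKer κ₁ κ₂ ≤ κ.kerSubgroup → γ₁ * γ⁻¹ ∈ κ.kerSubgroup → γ₂ * (γ ^ (3 ^ k))⁻¹ ∈ κ.kerSubgroup →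
    Module.Finite (IwasawaAlgebra₂ 3) ((W.baseChange K).XGr₂ 3 κ₁ κ₂ 𝔭' γ₁ γ₂) →
    Module.IsTorsion (IwasawaAlgebra₂ 3) ((W.baseChange K).XGr₂ 3 κ₁ κ₂ 𝔭' γ₁ γ₂) →
    (∀ N : Submodule (IwasawaAlgebra₂ 3) ((W.baseChange K).XGr₂ 3 κ₁ κ₂ 𝔭' γ₁ γ₂),
      Literature.NumberTheory.EllipticCurves.Module.IsPseudoNull (IwasawaAlgebra₂ 3) N → Finite N) →
    ∀ (g : IwasawaAlgebra₂ 3),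
      Literature.NumberTheory.EllipticCurves.Module.charIdeal (IwasawaAlgebra₂ 3)
        ((W.baseChange K).XGr₂ 3 κ₁ κ₂ 𝔭' γ₁ γ₂) = Ideal.span {g} →
    ∀ (L₂ : PowerSeries (PowerSeries (unrIntegers 3))) (L : UnrSeries 3),
      PowerSeries.map (PowerSeries.map (Summit.BirchSwinnertonDyer.Rank1Residual.X11b.Halves.toUnr 3)) g ∣ L₂ →
      (∃ u : (PowerSeries (PowerSeries (unrIntegers 3)))ˣ,
        L₂ - u * PowerSeries.map (PowerSeries.C (R := unrIntegers 3)) L ∈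
          Ideal.span {T₂ (unrIntegers 3) - ((1 + T₁ (unrIntegers 3)) ^ (3 ^ k) - 1)}) →
      Ideal.span {L} ≤ (Summit.BirchSwinnertonDyer.Rank1Residual.X11b.AcSelmer.XAc.charIdeal (W.baseChange K) 3 κ 𝔭' ∅ γ).map
        (PowerSeries.map (Summit.BirchSwinnertonDyer.Rank1Residual.X11b.Halves.toUnr 3)) := by
  sorry

/-- **Composition** (kernel-checked, no `sorry` outside the stubs; v4.2 probe): the seven stubs give the crux BY NAME; the
∀-frame universality is discharged by `span_singleton_eq_of_isBDPLFunction`. -/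
theorem AdditiveSplitIMCInclusionAtThree_of :
    Summit.BirchSwinnertonDyer.BirchSwinnertonDyer.Theses.UniversalToricDescent.AdditiveSplitIMCInclusionAtThree := by
  intro W _ _ N _ K _ _ Dt hO6 hsurj hrk hN hK hH κ hκ γ hγ 𝔭 h3 hram hdeg 𝔭' h3' hne ι' hι ΩK Ωp L hΩK hΩp hL
  obtain ⟨κ₁, κ₂, γ₁, γ₂, k, hpair, hur₁, hker, hγ₁, hγ₂⟩ :=
    stub_frame K hK κ hκ γ hγ.out 𝔭 h3 𝔭' h3' hne
  haveI : Fact (ZpExtension.IsTopGeneratorPair κ₁ κ₂ γ₁ γ₂) := ⟨hpair⟩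
  obtain ⟨g, hg⟩ := (stub_charIdealPrincipal ((W.baseChange K).XGr₂ 3 κ₁ κ₂ 𝔭' γ₁ γ₂))
  have hg' : Literature.NumberTheory.EllipticCurves.Module.charIdeal (IwasawaAlgebra₂ 3)
      ((W.baseChange K).XGr₂ 3 κ₁ κ₂ 𝔭' γ₁ γ₂) = Ideal.span {g} := by
    simpa [Ideal.submodule_span_eq] using hg
  have hfin : Module.Finite (IwasawaAlgebra₂ 3) ((W.baseChange K).XGr₂ 3 κ₁ κ₂ 𝔭' γ₁ γ₂) :=
    Summit.BirchSwinnertonDyer.BirchSwinnertonDyer.Theorems.SignedBaseChangeAcDivFinitePiece.xGr₂_module_finite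
      (W.baseChange K) 3 κ₁ κ₂ 𝔭'
  obtain ⟨ΩK', Ωp', L₂, L', hΩK', hΩp', hL₂, hL', hcong⟩ :=
    stub_toricTwoVarL W N K Dt hO6 hsurj hrk hN hK hH κ hκ γ 𝔭 h3 hram hdeg 𝔭' h3' hne ι' hι κ₁ κ₂ γ₁ γ₂ k
      hur₁ hker hγ₁ hγ₂ ΩK Ωp L hΩK hΩp hL
  -- cross-period rigidity (tree theorem, utd-p2 p536114): the handed frame and K3's companion span the same ideal
  have hspan : Ideal.span ({L'} : Set (UnrSeries 3)) = Ideal.span {L} :=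
    Summit.BirchSwinnertonDyer.BirchSwinnertonDyer.Theorems.UniversalToricDescentTwinSplit.span_singleton_eq_of_isBDPLFunction
      hK hκ hγ.out hΩK hΩK' hΩp hΩp' hL hL'
  obtain ⟨htors, ρ, hρc, hρT, hGsym, hLsym, hcomb⟩ :=
    stub_combDivisibility W N K Dt hO6 hsurj hrk hN hK hH 𝔭 h3 hram hdeg 𝔭' h3' hne ι' hι κ₁ κ₂ γ₁ γ₂
      hur₁ g hg' ΩK' Ωp' L₂ hΩK' hΩp' hL₂
  have hdvd := stub_weakRigidity ρ hρc hρT _ L₂ hGsym hLsym hcomb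
  have hPN := stub_noPseudoNull W K hO6 hsurj hK κ hκ γ 𝔭 h3 𝔭' h3' hne κ₁ κ₂ γ₁ γ₂ k hur₁ hker hγ₁ hγ₂
    hfin htors
  rw [← hspan]
  exact stub_descent W K hO6 hsurj hK κ hκ γ 𝔭 h3 𝔭' h3' hne κ₁ κ₂ γ₁ γ₂ k hur₁ hker hγ₁ hγ₂ hfin htors hPN
    g hg' L₂ L' hdvd hcong

end Summit.BirchSwinnertonDyer.BirchSwinnertonDyer.Cruxes.AdditiveSplitIMCInclusionAtThree.ThinCombV4Pen

end
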